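import Summits.QuantumFields.BalabanUV.T4Continuum.Support.NE7CurvedExactLift
import Summits.QuantumFields.BalabanUV.T4Continuum.Support.NE7PerturbedCompositesAdd
import Summits.QuantumFields.BalabanUV.T4Continuum.Support.NE3TangentCovariantStructure
import HarnessLib

/-!
# NE7CurvedExactLiftComposites — (C_W): THE COMPOSITES OF THE CURVED EXACT LIFTS ALONG A TOWER OF SMALL-FIELD BACKGROUNDS ARE BOUNDED WITH THE SAME RATIO `ρ` (`ρ² = 7.197 < 8`):
# **`√dirSq (r_{W_i}∘⋯∘r_{W_{i+t−1}} u) [0,Q_i)⁴ ≤ C̄·exp((C̄∕ρ)·Σ_{j<t} etaW(x_{i+j}, b_{i+j}))·ρ^t·√dirSq u [0,Q_{i+t})⁴`** (`d = 4`, `L = 2`, every `U(n)`, `u` skew periodic, `Q_i = P·2^{T−i}`)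
# — j-UNIFORM as soon as `Σ_j (x_j + b_j)` is bounded along the tower (memo SCOPING-R4 §2: `N_i a_i` and `1∕N_i` are geometric in the depth)
# (lineage `b2b-balaban-t4-ne7b-p1`, gen 163; route (H′), memo `t4/b2b-balaban-t4-ne7b-p1/g163/records/SCOPING-R4.md` §2–§5, file (R4d))

Cell `pub-balaban`, rung (B)+1 sub-cell t4, lineage `b2b-balaban-t4-ne7b-p1` (row NE7b OWNER + CRUX PROVER; junction service for row NE7 on ROAD-G116 §6 (G3) ∕ the ℓ² route to (G′)),
generation 163.
WHY.  ✓ `NE7ExactLiftComposites.sqrt_dirSq_liftIter_le` is (C) for the flat lift `r`; ✓ `NE7CurvedExactLift` gives the exact lift `r_W = r − R₀^W(δ_W)` at a one-level class background with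
`√dirSq(r_W w − r w) ≤ etaW(x,b)·√dirSq w`; ✓ `NE7PerturbedCompositesAdd.perturbed_compA_le_exp` turns run letters + perturbation letters into composite letters with the ratio unchanged.
THIS FILE assembles them along a tower: backgrounds `W_i` (one-level class data `x_i`, bondwise radii `b_i`), periods `Q_i = P·2^{T−i}`, the additive maps `r_i = exactLift 2 Q_{i+1}` and
`δ_i = −R₀^{W_i}(skewP∘δ_{W_i})` on ALL 1-forms (the skew projection makes row NE3's proof-dependent `R₀` total; on skew data `r_i + δ_i = curvedLift`), the predicate «skew ∧ `Q_i`-periodic ∧ `i ≤ T`».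
WHAT ([folklore]; DATA defs `Qper`, `exactLiftHom`, `skewPart`, `corr`, `corrHom`, `rTower`, `dTower`, `etaTower`, `GoodT`, `pT`; 0 sorry; `d = 4`, `L = 2`):
§1 `exactLift_zero`, `exactLift_add`, `exactLiftHom`; `skewPart` (pointwise ✓ `skewP`), `rightInvW0_congr`, `corr_add`, `corrHom`, **`exactLift_sub_corr_eq_curvedLift`** (on skew data);
§2 the tower data (`TowerHyps`: the one-level class lines at every level `i < T`), `rTower`, `dTower`, `GoodT`, `pT`, `compA_rTower_eq_liftIter`;
§3 **`curved_composite_le`**: for `u` skew and `Q_{i+t}`-periodic (`i + t ≤ T`),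
   `√dirSq (compA (rTower + dTower) i t u) [0,Q_i)⁴ ≤ (Kmain+Dgauge)·exp(((Kmain+Dgauge)∕ρ)·Σ_{j<t} etaW(x_{i+j}, b_{i+j}))·ρ^t·√dirSq u [0,Q_{i+t})⁴`,
   and `rTower_add_dTower_apply` (each step IS the curved exact lift ✓ `curvedLift`, hence exact: `cpush_step`).
WHAT IS NOT HERE: the discharge of the bondwise radii `b_i` (a periodic gauge of the finest configuration; memo §4 — the road's near-flat family), the curved curl letter, (K), (G3).
HONEST FRAMING (page 1): bookkeeping over kernel theorems about OUR lifts; the constant is astronomical and N-dependent through `Σ b_i`; nothing of Bałaban's asserted; NOT (G3), NOT (G′), NOT NE7∕NE3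
as spine nodes; row NE7b NOT PRINTED ∕ NOT PROVED; spine 0∕9; finite T⁴ rung (B)+1 — NOT infinite volume, NOT mass gap, NOT BetaPertH, NOT Clay.
-/

set_option autoImplicit false

open scoped BigOperators Matrix Matrix.Norms.L2Operator
open Finset

namespace Summit.QuantumFields.BalabanUV.T4Continuum.NE7CurvedExactLiftComposites

open Literature.MathematicalPhysics.QuantumFieldTheory.Balaban1983to89
open B7Prop1Explicit
open T4AveragingDeficitWall (IsUnitaryCfg IsSkewDir SmallField dirSq)
open T4AveragingDeficitWallBoundary (IsPeriodicCfg periodBox)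
open AveragingDeficitPeriodicCounting (IsPeriodicDir)
open AveragingDeficitTwoLevelPrep (prop1Radius)
open AveragingDeficitMultiLevelPrep (cpush tower LevelSmall)
open AveragingDeficitTorusChart (skewP skewP_mem skewP_of_mem)
open SpreadLift (loopRad)
open NE3QbarIterCovLiftPrep (cruxC)
open NE3RightInverseSolveLetters (thetaLoc)
open NE3TangentCovariantTower (step_small)
open NE3TangentCovariantStructure (cpush_add)
open NE3LiftDefectCorrection (sqrt_dirSq_add_le)
open NE3EnergyHessContTwoTerm (dirSq_nonneg)
open NE7FrameFreeRightInverse (rightInvW0 isSkewDir_rightInvW0 isPeriodicDir_rightInvW0 rightInvW0_sub)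
open NE7ExactLiftGaugePart (exactLift exactLift_sub exactLift_periodic)
open NE7ExactLiftComposites (liftIter rho rho_nonneg two_le_rho Kmain Dgauge Kmain_nonneg Dgauge_nonneg sqrt_dirSq_liftIter_le)
open NE7CurvedExactLift (defect curvedLift etaW etaW_nonneg isSkewDir_exactLift isSkewDir_defect cpush_curvedLift isSkewDir_curvedLift isPeriodicDir_curvedLift
  sqrt_dirSq_curvedLift_sub_exactLift_le)
open NE7PerturbedCompositesAdd (compA compA_succ_apply perturbed_compA_le_exp)

noncomputable section

variable {n : Type*} [Fintype n] [DecidableEq n]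

/-! ## §1 The flat lift and the curved correction as additive maps on all 1-forms -/

/-- `exactLift M N 0 = 0`. [folklore] -/
theorem exactLift_zero (M N : ℕ) : exactLift M N (0 : Site 4 → Fin 4 → Matrix n n ℂ) = 0 := by
  have h := exactLift_sub M N (0 : Site 4 → Fin 4 → Matrix n n ℂ) 0
  rw [sub_zero, sub_self] at h
  exact h

/-- `exactLift` is additive. [folklore] -/
theorem exactLift_add (M N : ℕ) (u v : Site 4 → Fin 4 → Matrix n n ℂ) : exactLift M N (u + v) = exactLift M N u + exactLift M N v := by
  have h := exactLift_sub M N (u + v) v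
  rw [add_sub_cancel_right] at h
  rw [← sub_eq_iff_eq_add.mp h.symm]

/-- **THE FLAT EXACT LIFT AS AN ADDITIVE MAP.** [folklore] -/
def exactLiftHom (M N : ℕ) : (Site 4 → Fin 4 → Matrix n n ℂ) →+ (Site 4 → Fin 4 → Matrix n n ℂ) where
  toFun := exactLift M N
  map_zero' := exactLift_zero M N
  map_add' := exactLift_add M N

/-- The pointwise skew projection of a 1-form. [folklore] -/
def skewPart (Y : Site 4 → Fin 4 → Matrix n n ℂ) : Site 4 → Fin 4 → Matrix n n ℂ := fun x κ => skewP (Y x κ)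

omit [DecidableEq n] in
/-- The skew projection is skew. [folklore] -/
theorem isSkewDir_skewPart (Y : Site 4 → Fin 4 → Matrix n n ℂ) : IsSkewDir (skewPart Y) := fun _ _ => skewP_mem _

omit [DecidableEq n] in
/-- The skew projection fixes skew 1-forms. [folklore] -/
theorem skewPart_of_skew {Y : Site 4 → Fin 4 → Matrix n n ℂ} (hY : IsSkewDir Y) : skewPart Y = Y := by
  funext x κ; exact skewP_of_mem (hY x κ)

omit [DecidableEq n] in
/-- The skew projection is additive. [folklore] -/
theorem skewPart_add (Y Z : Site 4 → Fin 4 → Matrix n n ℂ) : skewPart (Y + Z) = skewPart Y + skewPart Z := by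
  funext x κ; simp only [skewPart, Pi.add_apply, map_add]

section OneLevel

variable [Nonempty n] {W : Site 4 → Fin 4 → (Matrix n n ℂ)ˣ} {x : ℝ} (hWu : IsUnitaryCfg W) (hx : 0 ≤ x) (hs : LevelSmall 4 2 0 x)
  (hWx : SmallField W x) (N : ℕ) [NeZero N] (hθ : cruxC 4 2 * ((((2 : ℕ) : ℝ) ^ (0 + 1)) ^ 2 * x) < 1)
  (hE : 4 * ((4 : ℕ) : ℝ) ^ 2 * (((2 : ℕ) : ℝ) ^ (0 + 1) - 1) ^ 2 * x + 16 * (4 : ℕ) * loopRad 4 2 ((prop1Radius 4 2)^[0] x) ≤ 1 / 2)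

/-- Row NE3's `R₀` does not depend on the skewness witness, and agrees on equal data. [folklore] -/
theorem rightInvW0_congr {φ ψ : Site 4 → Fin 4 → Matrix n n ℂ} (hφ : IsSkewDir φ) (hψ : IsSkewDir ψ) (h : φ = ψ) :
    rightInvW0 (d := 4) (by norm_num) 0 hWu hx hs hWx N hθ hE hφ = rightInvW0 (d := 4) (by norm_num) 0 hWu hx hs hWx N hθ hE hψ := by
  subst h; rfl

/-- **THE TOTAL CURVED CORRECTION** `corr w := R₀^W(skewP ∘ δ_W w)` (defined on all 1-forms; `= R₀^W(δ_W w)` on skew data). [folklore] -/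
def corr (w : Site 4 → Fin 4 → Matrix n n ℂ) : Site 4 → Fin 4 → Matrix n n ℂ :=
  rightInvW0 (d := 4) (by norm_num) 0 hWu hx hs hWx N hθ hE (isSkewDir_skewPart (defect (L := 2) (W := W) N w))

omit [NeZero N] in
include hWu hx hs hWx in
/-- The defect is additive. [folklore] -/
theorem defect_add (u v : Site 4 → Fin 4 → Matrix n n ℂ) : defect (L := 2) (W := W) N (u + v) = defect (L := 2) (W := W) N u + defect (L := 2) (W := W) N v := by
  obtain ⟨h512, -, -, -⟩ := step_small (d := 4) (by norm_num : 1 ≤ 2) hWu hx hs.two hWx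
  funext z κ
  simp only [defect, Pi.add_apply, exactLift_add]
  have h := congr_fun (congr_fun (cpush_add (by norm_num : 1 ≤ 2) hWu hx h512 hWx (exactLift 2 N u) (exactLift 2 N v)) z) κ
  have hfun : (fun y μ => exactLift 2 N u y μ + exactLift 2 N v y μ) = exactLift 2 N u + exactLift 2 N v := rfl
  rw [hfun] at h
  rw [h]
  abel

/-- **`corr` IS ADDITIVE** (✓ `rightInvW0_sub`). [folklore] -/
theorem corr_add (u v : Site 4 → Fin 4 → Matrix n n ℂ) : corr hWu hx hs hWx N hθ hE (u + v) = corr hWu hx hs hWx N hθ hE u + corr hWu hx hs hWx N hθ hE v := by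
  -- `skewP δ(u+v) − skewP δ(v) = skewP δ(u)` as data
  have hsum : skewPart (defect (L := 2) (W := W) N (u + v)) = skewPart (defect (L := 2) (W := W) N u) + skewPart (defect (L := 2) (W := W) N v) := by
    rw [defect_add hWu hx hs hWx N, skewPart_add]
  have hdiff : (fun y μ => skewPart (defect (L := 2) (W := W) N (u + v)) y μ - skewPart (defect (L := 2) (W := W) N v) y μ) = skewPart (defect (L := 2) (W := W) N u) := by
    funext y μ; rw [hsum]; simp
  have hdiffs : IsSkewDir (fun y μ => skewPart (defect (L := 2) (W := W) N (u + v)) y μ - skewPart (defect (L := 2) (W := W) N v) y μ) := by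
    rw [hdiff]; exact isSkewDir_skewPart _
  have hsub := rightInvW0_sub (d := 4) (by norm_num : 2 ≤ 2) 0 hWu hx hs hWx N hθ hE (isSkewDir_skewPart (defect (L := 2) (W := W) N (u + v)))
    (isSkewDir_skewPart (defect (L := 2) (W := W) N v)) hdiffs
  have hc := rightInvW0_congr hWu hx hs hWx N hθ hE hdiffs (isSkewDir_skewPart (defect (L := 2) (W := W) N u)) hdiff
  funext y ν
  have h := hsub y ν
  rw [hc] at h
  simp only [corr, Pi.add_apply]
  rw [h]
  abel

/-- **THE CURVED CORRECTION AS AN ADDITIVE MAP.** [folklore] -/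
def corrHom : (Site 4 → Fin 4 → Matrix n n ℂ) →+ (Site 4 → Fin 4 → Matrix n n ℂ) :=
  AddMonoidHom.mk' (corr hWu hx hs hWx N hθ hE) (corr_add hWu hx hs hWx N hθ hE)

/-- **ON SKEW DATA, `r w − corr w` IS THE CURVED EXACT LIFT ✓ `curvedLift`.** [folklore] -/
theorem exactLift_sub_corr_eq_curvedLift {w : Site 4 → Fin 4 → Matrix n n ℂ} (hw : IsSkewDir w) :
    exactLift 2 N w - corr hWu hx hs hWx N hθ hE w = curvedLift (by norm_num) hWu hx hs hWx N hθ hE hw := by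
  have hc := rightInvW0_congr hWu hx hs hWx N hθ hE (isSkewDir_skewPart (defect (L := 2) (W := W) N w)) (isSkewDir_defect (d := 4) (by norm_num) hWu hx hs hWx N hw)
    (skewPart_of_skew (isSkewDir_defect (d := 4) (by norm_num) hWu hx hs hWx N hw))
  funext y ν
  simp only [Pi.sub_apply, corr, curvedLift, hc]

end OneLevel

/-! ## §2 The tower data and the maps -/

/-- The period at index `i` of a tower with top index `T` and top period `P`: `Q_i = P·2^{T−i}` (`Q_i = 2·Q_{i+1}` for `i < T`). [folklore] -/
def Qper (P T i : ℕ) : ℕ := P * 2 ^ (T - i)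

/-- `Q_i ≠ 0` for `P ≠ 0`. [folklore] -/
instance Qper_neZero (P T i : ℕ) [NeZero P] : NeZero (Qper P T i) := by unfold Qper; infer_instance

/-- `Q_i = 2·Q_{i+1}` for `i < T`. [folklore] -/
theorem Qper_succ {P T i : ℕ} (h : i < T) : Qper P T i = 2 * Qper P T (i + 1) := by
  unfold Qper
  rw [show T - i = (T - (i + 1)) + 1 by omega, pow_succ]; ring

/-- `Q_i = 2^t·Q_{i+t}` for `i + t ≤ T`. [folklore] -/
theorem Qper_add {P T i t : ℕ} (h : i + t ≤ T) : Qper P T i = 2 ^ t * Qper P T (i + t) := by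
  unfold Qper
  rw [show T - i = (T - (i + t)) + t by omega, pow_add]; ring

/-- **THE ONE-LEVEL CLASS DATA OF A TOWER** (`d = 4`, `L = 2`): at every index `i < T` a background `W i` (to lift from period `Q_{i+1}` to `Q_i = 2Q_{i+1}`) with the class lines of
row NE3's right inverse, the period, and a bondwise radius `b i` — a HYPOTHESIS SHAPE, asserted of nothing. [folklore] -/
@[folklore]
structure TowerHyps (n : Type*) [Fintype n] [DecidableEq n] [Nonempty n] (P T : ℕ) (W : ℕ → Site 4 → Fin 4 → (Matrix n n ℂ)ˣ) (x b : ℕ → ℝ) : Prop where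
  hWu : ∀ i, i < T → IsUnitaryCfg (W i)
  hx : ∀ i, i < T → 0 ≤ x i
  hs : ∀ i, i < T → LevelSmall 4 2 0 (x i)
  hWx : ∀ i, i < T → SmallField (W i) (x i)
  hθ : ∀ i, i < T → cruxC 4 2 * ((((2 : ℕ) : ℝ) ^ (0 + 1)) ^ 2 * x i) < 1
  hE : ∀ i, i < T → 4 * ((4 : ℕ) : ℝ) ^ 2 * (((2 : ℕ) : ℝ) ^ (0 + 1) - 1) ^ 2 * x i + 16 * (4 : ℕ) * loopRad 4 2 ((prop1Radius 4 2)^[0] (x i)) ≤ 1 / 2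
  hWP : ∀ i, i < T → IsPeriodicCfg (W i) ((tower 2 (Qper P T (i + 1)) (0 + 1) : ℕ) : ℤ)
  hθl2 : ∀ i, i < T → thetaLoc 4 2 * ((((2 : ℕ) : ℝ) ^ (0 + 1)) ^ 2 * x i) ≤ 1 / 2
  hε : ∀ i, i < T → (((2 : ℕ) : ℝ) ^ (0 + 1)) ^ 2 * x i ≤ 1
  hb : ∀ i, i < T → 0 ≤ b i
  hWb : ∀ i, i < T → ∀ (y : Site 4) (μ : Fin 4), ‖((W i y μ : (Matrix n n ℂ)ˣ) : Matrix n n ℂ) - 1‖ ≤ b i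

section Tower

variable [Nonempty n] {P T : ℕ} [NeZero P] {W : ℕ → Site 4 → Fin 4 → (Matrix n n ℂ)ˣ} {x b : ℕ → ℝ}

/-- **THE FLAT LIFTS OF THE TOWER**: `r_i = exactLift 2 Q_{i+1}`. [folklore] -/
def rTower (P T : ℕ) (i : ℕ) : (Site 4 → Fin 4 → Matrix n n ℂ) →+ (Site 4 → Fin 4 → Matrix n n ℂ) := exactLiftHom 2 (Qper P T (i + 1))

/-- **THE CURVED CORRECTIONS OF THE TOWER**: `δ_i = −corr^{W_i}` for `i < T`, `0` beyond. [folklore] -/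
def dTower (H : TowerHyps n P T W x b) (i : ℕ) : (Site 4 → Fin 4 → Matrix n n ℂ) →+ (Site 4 → Fin 4 → Matrix n n ℂ) :=
  if h : i < T then -(corrHom (H.hWu i h) (H.hx i h) (H.hs i h) (H.hWx i h) (Qper P T (i + 1)) (H.hθ i h) (H.hE i h)) else 0

/-- The perturbation sizes of the tower: `η_i = etaW(x_i, b_i)` for `i < T`, `0` beyond. [folklore] -/
def etaTower (x b : ℕ → ℝ) (T : ℕ) (i : ℕ) : ℝ := if i < T then etaW n (x i) (b i) else 0

/-- The predicate: `i ≤ T`, skew, `Q_i`-periodic — a bookkeeping shape. [folklore] -/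
@[folklore]
def GoodT (P T : ℕ) (i : ℕ) (u : Site 4 → Fin 4 → Matrix n n ℂ) : Prop := i ≤ T ∧ IsSkewDir u ∧ IsPeriodicDir u (Qper P T i : ℤ)

/-- The level seminorms: `p_i(u) = √dirSq u [0,Q_i)⁴`. [folklore] -/
def pT (P T : ℕ) (i : ℕ) (u : Site 4 → Fin 4 → Matrix n n ℂ) : ℝ := Real.sqrt (dirSq u (periodBox (d := 4) (Qper P T i)))

/-- **EACH STEP OF `rTower + dTower` IS THE CURVED EXACT LIFT** on skew data (`i < T`). [folklore] -/
theorem rTower_add_dTower_apply (H : TowerHyps n P T W x b) {i : ℕ} (h : i < T) {w : Site 4 → Fin 4 → Matrix n n ℂ} (hw : IsSkewDir w) :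
    (rTower (n := n) P T + dTower H) i w = curvedLift (by norm_num) (H.hWu i h) (H.hx i h) (H.hs i h) (H.hWx i h) (Qper P T (i + 1)) (H.hθ i h) (H.hE i h) hw := by
  rw [Pi.add_apply, AddMonoidHom.add_apply]
  simp only [dTower, h, dif_pos, AddMonoidHom.neg_apply]
  rw [← sub_eq_add_neg]
  exact exactLift_sub_corr_eq_curvedLift (H.hWu i h) (H.hx i h) (H.hs i h) (H.hWx i h) (Qper P T (i + 1)) (H.hθ i h) (H.hE i h) hw

/-- **EXACTNESS OF EACH STEP**: `cpush 2 (W i) ((r+δ)_i w) = w` for skew `Q_{i+1}`-periodic `w` (`i < T`). [folklore] -/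
theorem cpush_step (H : TowerHyps n P T W x b) {i : ℕ} (h : i < T) {w : Site 4 → Fin 4 → Matrix n n ℂ} (hw : IsSkewDir w) (hwP : IsPeriodicDir w (Qper P T (i + 1) : ℤ)) :
    cpush 2 (W i) ((rTower (n := n) P T + dTower H) i w) = w := by
  rw [rTower_add_dTower_apply H h hw]
  exact cpush_curvedLift (d := 4) (by norm_num) (H.hWu i h) (H.hx i h) (H.hs i h) (H.hWx i h) (Qper P T (i + 1)) (H.hθ i h) (H.hE i h) (by norm_num) (H.hWP i h) hw hwP

omit [Nonempty n] [NeZero P] in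
/-- The runs of the flat lifts of the tower are ✓ `liftIter`: `compA rTower i t u = liftIter Q_{i+t} t u` (`i + t ≤ T`). [folklore] -/
theorem compA_rTower_eq_liftIter : ∀ (t i : ℕ), i + t ≤ T → ∀ u : Site 4 → Fin 4 → Matrix n n ℂ, compA (rTower (n := n) P T) i t u = liftIter (Qper P T (i + t)) t u := by
  intro t
  induction t with
  | zero => intro i _ u; simp [liftIter]
  | succ t ih =>
      intro i hit u
      rw [compA_succ_apply, ih (i + 1) (by omega) u, show i + (t + 1) = i + 1 + t by ring]
      show exactLift 2 (Qper P T (i + 1)) (liftIter (Qper P T (i + 1 + t)) t u) = exactLift 2 (2 ^ t * Qper P T (i + 1 + t)) (liftIter (Qper P T (i + 1 + t)) t u)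
      rw [← Qper_add (show i + 1 + t ≤ T by omega)]

/-! ## §3 The composite letter along the tower -/

/-- **(C_W) — THE COMPOSITES OF THE CURVED EXACT LIFTS ALONG THE TOWER** (`d = 4`, `L = 2`): for `i + t ≤ T` and `u` skew `Q_{i+t}`-periodic,
`√dirSq (compA (rTower + dTower) i t u) [0,Q_i)⁴ ≤ (Kmain+Dgauge)·exp(((Kmain+Dgauge)∕ρ)·Σ_{j<t} etaW(x_{i+j},b_{i+j}))·ρ^t·√dirSq u [0,Q_{i+t})⁴`. [folklore] -/
theorem curved_composite_le (H : TowerHyps n P T W x b) (t i : ℕ) (hit : i + t ≤ T) {u : Site 4 → Fin 4 → Matrix n n ℂ} (hu : IsSkewDir u) (huP : IsPeriodicDir u (Qper P T (i + t) : ℤ)) :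
    Real.sqrt (dirSq (compA (rTower (n := n) P T + dTower H) i t u) (periodBox (d := 4) (Qper P T i)))
      ≤ (Kmain n + Dgauge n) * Real.exp (((Kmain n + Dgauge n) / rho) * ∑ j ∈ range t, etaTower (n := n) x b T (i + j)) * rho ^ t
          * Real.sqrt (dirSq u (periodBox (d := 4) (Qper P T (i + t)))) := by
  have hρ : 0 < rho := lt_of_lt_of_le (by norm_num) two_le_rho
  have hCb : 0 ≤ Kmain n + Dgauge n := add_nonneg Kmain_nonneg Dgauge_nonneg
  -- the hypotheses of the abstract perturbation lemma
  have hp0 : ∀ i, pT (n := n) P T i 0 = 0 := fun i => by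
    simp only [pT]; rw [show dirSq (0 : Site 4 → Fin 4 → Matrix n n ℂ) (periodBox (d := 4) (Qper P T i)) = 0 by simp [dirSq], Real.sqrt_zero]
  have hpadd : ∀ i (a c : Site 4 → Fin 4 → Matrix n n ℂ), pT (n := n) P T i (a + c) ≤ pT P T i a + pT P T i c := fun i a c => sqrt_dirSq_add_le a c _
  have hpnn : ∀ i (a : Site 4 → Fin 4 → Matrix n n ℂ), 0 ≤ pT (n := n) P T i a := fun i a => Real.sqrt_nonneg _
  have hGadd : ∀ j (a c : Site 4 → Fin 4 → Matrix n n ℂ), GoodT (n := n) P T j a → GoodT P T j c → GoodT P T j (a + c) :=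
    fun j a c ha hc => ⟨ha.1, fun y κ => (skewAdjoint _).add_mem (ha.2.1 y κ) (hc.2.1 y κ), fun y k μ => by simp only [Pi.add_apply, ha.2.2 y k μ, hc.2.2 y k μ]⟩
  have hGr : ∀ j (a : Site 4 → Fin 4 → Matrix n n ℂ), GoodT (n := n) P T (j + 1) a → GoodT P T j (rTower (n := n) P T j a) := by
    intro j a ha
    have hj : j < T := by have := ha.1; omega
    refine ⟨hj.le, isSkewDir_exactLift 2 _ ha.2.1, fun y k μ => ?_⟩
    have h := exactLift_periodic (d := 4) (n := n) (by norm_num : 1 ≤ 2) (Qper P T (j + 1)) (fun y' j' κ' => ha.2.2 y' j' κ') y k μ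
    rw [show (((2 * Qper P T (j + 1) : ℕ) : ℤ)) = (Qper P T j : ℤ) by rw [Qper_succ hj]] at h
    exact h
  have hGδ : ∀ j (a : Site 4 → Fin 4 → Matrix n n ℂ), GoodT (n := n) P T (j + 1) a → GoodT P T j (dTower H j a) := by
    intro j a ha
    have hj : j < T := by have := ha.1; omega
    refine ⟨hj.le, ?_, ?_⟩
    · simp only [dTower, hj, dif_pos, AddMonoidHom.neg_apply]
      intro y κ
      rw [Pi.neg_apply, Pi.neg_apply]
      exact (skewAdjoint _).neg_mem (isSkewDir_rightInvW0 (d := 4) (by norm_num) 0 (H.hWu j hj) (H.hx j hj) (H.hs j hj) (H.hWx j hj) _ (H.hθ j hj) (H.hE j hj) _ y κ)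
    · simp only [dTower, hj, dif_pos, AddMonoidHom.neg_apply]
      intro y k μ
      rw [Pi.neg_apply, Pi.neg_apply, Pi.neg_apply, Pi.neg_apply]
      have h := isPeriodicDir_rightInvW0 (d := 4) (by norm_num) 0 (H.hWu j hj) (H.hx j hj) (H.hs j hj) (H.hWx j hj) (Qper P T (j + 1)) (H.hθ j hj) (H.hE j hj)
        (isSkewDir_skewPart (defect (L := 2) (W := W j) (Qper P T (j + 1)) a)) (H.hWP j hj) y k μ
      rw [show (((tower 2 (Qper P T (j + 1)) (0 + 1) : ℕ) : ℤ)) = (Qper P T j : ℤ) by simp [tower, Qper_succ hj]] at h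
      simp only [corrHom, AddMonoidHom.mk'_apply, corr]
      rw [h]
  have hR : ∀ (i t : ℕ) (a : Site 4 → Fin 4 → Matrix n n ℂ), GoodT (n := n) P T (i + t) a →
      pT (n := n) P T i (compA (rTower (n := n) P T) i t a) ≤ (Kmain n + Dgauge n) * rho ^ t * pT P T (i + t) a := by
    intro i t a ha
    have hN : 1 ≤ Qper P T (i + t) := Nat.one_le_iff_ne_zero.mpr (NeZero.ne _)
    simp only [pT]
    rw [compA_rTower_eq_liftIter t i ha.1 a, Qper_add ha.1]
    exact sqrt_dirSq_liftIter_le hN (fun y j κ => ha.2.2 y j κ) t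
  have hδ : ∀ (j : ℕ) (a : Site 4 → Fin 4 → Matrix n n ℂ), GoodT (n := n) P T (j + 1) a → pT (n := n) P T j (dTower H j a) ≤ etaTower (n := n) x b T j * pT P T (j + 1) a := by
    intro j a ha
    have hj : j < T := by have := ha.1; omega
    simp only [pT, etaTower, hj, if_true]
    have h := sqrt_dirSq_curvedLift_sub_exactLift_le (H.hWu j hj) (H.hx j hj) (H.hs j hj) (H.hWx j hj) (Qper P T (j + 1)) (H.hθ j hj) (H.hE j hj)
      (H.hWP j hj) (H.hθl2 j hj) (H.hε j hj) (H.hb j hj) (H.hWb j hj) ha.2.1 ha.2.2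
    have hδeq : dTower H j a = fun y ν => curvedLift (by norm_num) (H.hWu j hj) (H.hx j hj) (H.hs j hj) (H.hWx j hj) (Qper P T (j + 1)) (H.hθ j hj) (H.hE j hj) ha.2.1 y ν - exactLift 2 (Qper P T (j + 1)) a y ν := by
      rw [← exactLift_sub_corr_eq_curvedLift (H.hWu j hj) (H.hx j hj) (H.hs j hj) (H.hWx j hj) (Qper P T (j + 1)) (H.hθ j hj) (H.hE j hj) ha.2.1]
      simp only [dTower, hj, dif_pos, AddMonoidHom.neg_apply, corrHom, AddMonoidHom.mk'_apply]
      funext y ν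
      simp only [Pi.neg_apply, Pi.sub_apply]
      abel
    rw [hδeq, Qper_succ hj]
    exact h
  have hη : ∀ j, 0 ≤ etaTower (n := n) x b T j := fun j => by
    simp only [etaTower]; split_ifs with hj
    · exact etaW_nonneg (H.hx j hj) (H.hb j hj)
    · exact le_rfl
  have hGood : GoodT (n := n) P T (i + t) u := ⟨hit, hu, huP⟩
  exact perturbed_compA_le_exp (pT (n := n) P T) (GoodT (n := n) P T) (rTower (n := n) P T) (dTower H) hp0 hpadd hpnn hGadd hGr hGδ hCb hρ hη hR hδ t i u hGood

end Tower

end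

end Summit.QuantumFields.BalabanUV.T4Continuum.NE7CurvedExactLiftComposites
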